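import Mathlib
import HarnessLib
import Summits.ResolutionOfSingularities.ResolutionOfSingularities.Theorems.WildQuotientsWildQuotientResolutionS1aKillConormal
import Summits.ResolutionOfSingularities.ResolutionOfSingularities.Theorems.WildQuotientsWildQuotientResolutionS1aJ22KillsIn

/-!
# S1a — INSTANCE I-5c (j3): the linear `J₃ ⊕ J₁` datum is KILLED BY ONE MOVE, `KillsIn 1 (initial)` (datum inhabited for every prime `p ≥ 3`)

[OURS · L1 W4.5c · lead-1 g14; plan-1 RULING R-F15g (2) / CHAIN v10.44 §4 «I-5c j3 = J₍₃,₁₎ (σ: x₁ ↦ x₁ + x₀, x₂ ↦ x₂ + x₁, x₀, x₃ fixed; p ≥ 3):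
`j3_killsIn_one : KillsIn 1 (initial)` by the a1/D₄ move 1 (x₀:2, x₁:1; δ1): [x₀]₂ killed by the row of x₁′, N(x₁) killed at once by the row σ(x₂) = x₂ + e₁»,
X-CERT v1.3-SMALLP §3] — NOT statements of the manuscript; counted 0; AI-level work, weaker than expert review. Crux stmt-ResolutionOfSingularities-17941
`CyclicQuotientFourfolds`, line `s1a-logminvertex` v13 (`stub_reachLowerInFX`). A BC5-type RUNG of the research stub, not the stub.

THE GERM: action data `(X′, X₁, q, ρ, g₀)` with `X′` AFFINE regular (locally Noetherian, separated), `q` affine and `G`-invariant, `G = ⟨g₀⟩` finite with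
`g₀ ^ p = 1`, and a ring isomorphism `e : Γ(X′, ⊤) ≃ k[x₀..x₃]` intertwining `g₀` with `σ` (`x₀ ↦ x₀`, `x₁ ↦ x₁ + x₀`, `x₂ ↦ x₂ + x₁`, `x₃ ↦ x₃`, constants
fixed). (`σ` has order `p` in characteristic `p` iff `p ≥ 3`; the theorems below carry `g₀ ^ p = 1` and the intertwiner as hypotheses and hold for every `p`.)

THE MOVE, in the I-1 architecture (one chart = `X′` itself; NOT the two-chart a1 move-1 assembly — the KillCert pipeline already quantifies over every
σ-fixed chart of the cobordant blow-up, norm charts included): the (2,1)-weighted centre `(e⁻¹x₀, e⁻¹x₁)` on the fixed plane `V(x₀, x₁)` is the SMOOTH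
TRANSVERSAL (2,1)-TYPE of KILL-CRITERION v1 KC4 with `β = h = u = 1`, `x₄ = e⁻¹x₂` (`σx₁ − x₁ = x₀`, `σx₂ − x₂ = x₁`): `cobordantKillCert_smoothTransversalType`
(✓p636398) gives the cobordant kill certificate `s` on every σ-fixed chart, and `exists_isPrincipalCentre_filtration_eq_of_certCover` (✓p644505) with the
single chart `X′` makes it a PRINCIPAL CENTRE of the game on the initial model, `X′` a principal-centre chart, support = the fixed plane — exactly as
`J₄` (✓p645001, chain length 3) and `J₂ ⊕ J₂` (`…S1aJ22KillsIn`, two chains of length 1).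
* ★★★ `exists_isPrincipalCentre_initial_of_j3` — the datum-level move (all `p`);
* ★★★ `j3_killsIn_one : KillsIn 1 (GModel.initial hq h₀)` (`killsIn_one_of_principalCentreChart_top`) and ★★★ `exists_reachLowerF_initial_of_j3` —
  INSTANCE I-5c OF RECORD: for every root decoration `𝔄₀` the conclusion of `ReachLowerInF(X)` holds (`exists_reachLowerF_of_killsIn_datum` ✓p673404).
-/

set_option linter.dupNamespace false

noncomputable section

open CategoryTheory Limits AlgebraicGeometry TopologicalSpace Topology Opposite MvPolynomial
open Literature.AlgebraicGeometry.Resolution Literature.AlgebraicGeometry.RelativeSpec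
open Summit.ResolutionOfSingularities.ResolutionOfSingularities.Theorems.WildQuotientResolution.S1
open Summit.ResolutionOfSingularities.ResolutionOfSingularities.Theorems.WildQuotientResolution.S1.NodeAtlas
open Summit.ResolutionOfSingularities.ResolutionOfSingularities.Theorems.WildQuotientResolution.S1.KillCert
open Summit.ResolutionOfSingularities.ResolutionOfSingularities.Theorems.WildQuotientResolution.S1.GoodCharts
open Summit.ResolutionOfSingularities.ResolutionOfSingularities.Theorems.WildQuotientResolution.S1.NpFrame

namespace Summit.ResolutionOfSingularities.ResolutionOfSingularities.Theorems.WildQuotientResolution.S1.GameFrame.GModel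

open KillCert

variable {p : ℕ} {X' X₁ : Scheme.{0}} {q : X' ⟶ X₁} {G : Type} [Group G] {ρ : G →* Aut X'} {g₀ : G}

/-- ★★★ **THE LINEAR `J₃ ⊕ J₁` IS KILLED BY ONE MOVE OF THE GAME (all `p`).** Let `(X′, X₁, q, ρ, g₀)` be action data with `X′` AFFINE, regular, locally
Noetherian and separated, `X₁` separated, `q` affine and `G`-invariant, `G` finite, `g₀ ^ p = 1`, and let `e : Γ(X′, ⊤) ≃+* k[x₀..x₃]` intertwine the
action of `g₀` on global sections with `σ` (`σ x₀ = x₀`, `σ x₁ = x₁ + x₀`, `σ x₂ = x₂ + x₁`, `σ x₃ = x₃`, `σ` fixing constants). Then on the INITIAL MODEL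
the (2,1)-weighted centre on the fixed plane IS a legal PRINCIPAL (kill) move: `∃ 𝒦 d, IsPrincipalCentre p _ g₀ 𝒦 d` whose filtration on `X′` is
`𝒥ₙ((e⁻¹x₀, e⁻¹x₁), (2,1))`, whose support is EXACTLY the fixed plane `V(e⁻¹x₀, e⁻¹x₁)`, and for which every stable affine chart with underlying open
`⊤` (i.e. `X′`) is a principal-centre chart. [OURS · L1 W4.5c · R-F15g (2) I-5c; NOT a statement of the manuscript] -/
theorem exists_isPrincipalCentre_initial_of_j3 [Finite G] (hp : 0 < p) (hG : ∀ g : G, g ∈ Subgroup.zpowers g₀) (hg₀ : g₀ ^ p = 1)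
    (hq : ∀ g : G, (ρ g).hom ≫ q = q) [IsIntegral X'] [IsLocallyNoetherian X'] [X'.IsSeparated] [IsAffine X'] [X₁.IsSeparated] [IsAffineHom q]
    (hreg : Scheme.IsRegular X') {k : Type} [Field k] (σ : MvPolynomial (Fin 4) k ≃+* MvPolynomial (Fin 4) k) (hC : ∀ a : k, σ (C a) = C a)
    (h0 : σ (X 0) = X 0) (h1 : σ (X 1) = X 1 + X 0) (h2 : σ (X 2) = X 2 + X 1) (h3 : σ (X 3) = X 3)
    (e : Γ(X', ⊤) ≃+* MvPolynomial (Fin 4) k)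
    (hστ : ∀ t : Γ(X', ⊤), e ((ρ g₀⁻¹).hom.appLE ⊤ ⊤ (by rw [Scheme.Hom.preimage_top]) t) = σ (e t)) :
    letI h₀ : NodeAtlas p (⟨ρ, hq⟩ : ActionOver q G) g₀ := stub_initialAtlas p hp q G ρ g₀ hg₀ hq hreg
    ∃ (𝒦 : ReesFiltration X') (d : ℕ), IsPrincipalCentre p (GModel.initial hq h₀).act g₀ 𝒦 d ∧
      (∀ n, (𝒦.filtration ⟨⊤, isAffineOpen_top X'⟩).ideal n = (weightedFiltration (e.symm ∘ ![X 0, X 1]) ![2, 1]).ideal n) ∧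
      (((𝒦.ideal d).support : Set X')) = X'.zeroLocus (U := ⊤) (Set.range (e.symm ∘ ![X 0, X 1])) ∧
      ∀ O : (GModel.initial hq h₀).act.StableAffineOpens, O.1 = ⊤ → IsPrincipalCentreChart p (GModel.initial hq h₀).act g₀ 𝒦 d O := by
  classical
  -- the one chart: all of `X′`, affine over `X₁`
  haveI : IsAffine (⊤ : X'.Opens) := isAffineOpen_top X'
  have hAff : IsAffineHom ((⊤ : X'.Opens).ι ≫ q) := inferInstance
  have hst : ∀ g : G, (ρ g).hom ⁻¹ᵁ (⊤ : X'.Opens) = ⊤ := fun g => Scheme.Hom.preimage_top _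
  let O : (⟨ρ, hq⟩ : ActionOver q G).StableAffineOpens := ⟨⊤, hst, hAff⟩
  have hO : IsAffineOpen O.1 := isAffineOpen_top X'
  haveI hsep : (GModel.initial hq (stub_initialAtlas p hp q G ρ g₀ hg₀ hq hreg) : GModel p q G ρ g₀).V.IsSeparated := ‹X'.IsSeparated›
  -- the frame in `A = Γ(X′, ⊤)` and the automorphism `τ = g₀` acting on it
  let A := Γ(X', (⊤ : X'.Opens))
  let τ : A ≃+* A := actOEquiv (⟨ρ, hq⟩ : ActionOver q G) O g₀
  let f : Fin 2 → A := e.symm ∘ ![X 0, X 1]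
  have hact : ∀ t : A, τ t = e.symm (σ (e t)) := fun t => by
    apply e.injective
    rw [e.apply_symm_apply, ← hστ]
    rfl
  have hactX : ∀ y, τ (e.symm y) = e.symm (σ y) := fun y => by rw [hact, e.apply_symm_apply]
  have hf0 : f 0 = e.symm (X 0) := rfl
  have hf1 : f 1 = e.symm (X 1) := rfl
  have hw1 : (![2, 1] : Fin 2 → ℕ) 1 = 1 := rfl
  have hinc0 : τ (f 0) - f 0 = 0 := by rw [hf0, hactX, h0, sub_self]
  have hinc1 : τ (f 1) - f 1 = 1 * 1 * f 0 := by rw [hf1, hactX, h1, map_add, hf0]; ring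
  have hinc2 : τ (e.symm (X 2)) - e.symm (X 2) = 1 * 1 * f 1 := by rw [hactX, h2, map_add, hf1]; ring
  have hinc3 : τ (e.symm (X 3)) - e.symm (X 3) = 0 := by rw [hactX, h3, sub_self]
  have hX0 : f 0 ∈ (weightedFiltration f ![2, 1]).ideal 2 := mem_weightedFiltration_ideal f ![2, 1] 0
  have hX1 : f 1 ∈ (weightedFiltration f ![2, 1]).ideal 1 := mem_weightedFiltration_ideal f ![2, 1] 1
  have h1J : ∀ {n : ℕ} {y : A}, y ∈ (weightedFiltration f ![2, 1]).ideal n →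
      1 * 1 * y ∈ Ideal.span {(1 : A)} * (weightedFiltration f ![2, 1]).ideal n := fun hy => by
    rw [one_mul]
    exact Ideal.mul_mem_mul (Ideal.mem_span_singleton_self _) hy
  -- (a′): `τ` moves `𝒥ₙ` within `𝒥ₙ₊₁` — checked on the generators `e⁻¹(C a)`, `e⁻¹(xᵢ)` of `A`
  have hgen : Subring.closure (e.symm '' (Set.range (C : k → MvPolynomial (Fin 4) k) ∪ Set.range (X : Fin 4 → MvPolynomial (Fin 4) k))) = ⊤ := by
    show Subring.closure ((e.symm : MvPolynomial (Fin 4) k →+* A) '' _) = ⊤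
    rw [← RingHom.map_closure, closure_range_C_union_range_X k, ← RingHom.range_eq_map]
    exact RingHom.range_eq_top.mpr e.symm.surjective
  have m0 : τ (e.symm (X 0)) - e.symm (X 0) ∈ Ideal.span {(1 : A)} * (weightedFiltration f ![2, 1]).ideal 1 := by
    rw [← hf0, hinc0]; exact Ideal.zero_mem _
  have m1 : τ (e.symm (X 1)) - e.symm (X 1) ∈ Ideal.span {(1 : A)} * (weightedFiltration f ![2, 1]).ideal 1 := by
    rw [← hf1, hinc1]; exact h1J ((weightedFiltration f ![2, 1]).antitone (by norm_num : 1 ≤ 2) hX0)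
  have m2 : τ (e.symm (X 2)) - e.symm (X 2) ∈ Ideal.span {(1 : A)} * (weightedFiltration f ![2, 1]).ideal 1 := by
    rw [hinc2]; exact h1J hX1
  have m3 : τ (e.symm (X 3)) - e.symm (X 3) ∈ Ideal.span {(1 : A)} * (weightedFiltration f ![2, 1]).ideal 1 := by
    rw [hinc3]; exact Ideal.zero_mem _
  have hadm : ∀ (n : ℕ) (y : A), y ∈ (weightedFiltration f ![2, 1]).ideal n →
      τ y - y ∈ Ideal.span {(1 : A)} * (weightedFiltration f ![2, 1]).ideal (n + 1) := by
    refine admissible_of_generators f ![2, 1] τ 1 _ hgen ?_ ?_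
    · rintro _ ⟨g, hg | hg, rfl⟩
      · obtain ⟨a, rfl⟩ := hg
        rw [hactX, hC, sub_self]; exact Ideal.zero_mem _
      · obtain ⟨i, rfl⟩ := hg
        fin_cases i
        exacts [m0, m1, m2, m3]
    · intro i
      fin_cases i
      · change τ (f 0) - f 0 ∈ _
        rw [hinc0]; exact Ideal.zero_mem _
      · change τ (f 1) - f 1 ∈ Ideal.span {(1 : A)} * (weightedFiltration f ![2, 1]).ideal ((![2, 1] : Fin 2 → ℕ) 1 + 1)
        rw [hinc1, hw1]; exact h1J hX0
  have hσJ : ∀ n : ℕ, ((weightedFiltration f ![2, 1]).ideal n).map (τ : A →+* A) ≤ (weightedFiltration f ![2, 1]).ideal n :=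
    map_le_of_admissible f ![2, 1] τ 1 hadm
  -- (ii): isolation is trivial for `β = 1` — each `fᵢ` is itself an increment `τ y - y`
  have hiso : ∃ N : ℕ, Ideal.span (Set.range f) ^ N ≤ (augmentationIdeal τ).colon (Ideal.span {(1 : A)}) := by
    refine ⟨1, ?_⟩
    rw [pow_one, Ideal.span_le]
    rintro _ ⟨i, rfl⟩
    rw [SetLike.mem_coe, Ideal.mem_colon_span_singleton, mul_one]
    fin_cases i
    · change f 0 ∈ _
      rw [show f 0 = 1 * 1 * f 0 by ring, ← hinc1]; exact sub_mem_augmentationIdeal _ _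
    · change f 1 ∈ _
      rw [show f 1 = 1 * 1 * f 1 by ring, ← hinc2]; exact sub_mem_augmentationIdeal _ _
  -- the certificate `g = s` (KC3 ∘ KC4 with `β = h = u = 1`, `x₄ = e⁻¹ x₂`)
  have hcert : ∀ (hp' : 0 < p) (hσp : ∀ x, (⇑τ)^[p] x = x), ∃ g, CobordantKillCert f ![2, 1] τ hσJ hp' hσp g := fun hp' hσp =>
    ⟨_, cobordantKillCert_smoothTransversalType τ hp' hσp f 1 (e.symm (X 2)) 1 1 isUnit_one isUnit_one hσJ hadm hiso
      (by rw [hinc1, sub_self]; exact Ideal.zero_mem _) (by rw [hinc2, sub_self]; exact Ideal.zero_mem _)⟩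
  -- K1′ in `A`, transported from `k[x]`
  have hK1 : RingTheory.Sequence.IsRegular A (List.ofFn f) :=
    IsRegular.of_ringEquiv_ofFn e.symm ![X 0, X 1] (isRegular_X_X k (0 : Fin 4) 1 (by decide))
  have hK1' : IsRegularRing (A ⧸ Ideal.span (Set.range f)) :=
    isRegularRing_quotient_of_ringEquiv e.symm ![X 0, X 1] (isRegularRing_quotient_X_X k (0 : Fin 4) 1)
  -- the cover theorem with the single chart `X′`
  obtain ⟨𝒦, d, hprin, hsupp, hchart, hfil, hZ⟩ := exists_isPrincipalCentre_filtration_eq_of_certCover (ι := Fin 1) hG hg₀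
    (GModel.initial hq (stub_initialAtlas p hp q G ρ g₀ hg₀ hq hreg)) hreg (fun _ => O) (fun _ => hO)
    (fun _ => 2) (fun _ => f) (fun _ => ![2, 1]) (fun _ => by norm_num) (fun _ j => by fin_cases j <;> decide) (fun _ => hK1) (fun _ => hK1')
    (fun _ => hσJ) (fun _ => hcert) (fun _ _ _ _ _ _ => rfl)
    (B := X'.zeroLocus (U := ⊤) (Set.range f)) (X'.zeroLocus_isClosed _)
    (fun x _ => Set.mem_iUnion.mpr ⟨0, trivial⟩) (fun _ => Set.inter_subset_left)
  refine ⟨𝒦, d, hprin, hfil 0, le_antisymm hsupp fun x hx => hZ 0 ⟨hx, trivial⟩, fun O' hO' => ?_⟩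
  obtain rfl : O' = O := Subtype.ext hO'
  exact hchart 0

/-- ★★★ **INSTANCE I-5c: `KillsIn 1` FOR THE INITIAL MODEL OF THE `J₃ ⊕ J₁` DATUM (j3).** For the j3 datum (`X′` affine regular with
`Γ(X′, ⊤) ≃ k[x₀..x₃]` intertwining `g₀` with `σ: x₁ ↦ x₁ + x₀, x₂ ↦ x₂ + x₁`, `x₀, x₃` and constants fixed; `q` finite, `X₁ → Spec k′` locally of finite type):
ONE admissible move — the (2,1)-blow-up of the fixed plane, `X′` itself a principal-centre chart — all of whose realisations carry a node atlas with EMPTY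
formal locus. [OURS · L1 W4.5c · R-F15g (2) I-5c; NOT a statement of the manuscript] -/
theorem j3_killsIn_one [Finite G] (hp : p.Prime) (hG : ∀ g : G, g ∈ Subgroup.zpowers g₀) (hg₀ : g₀ ^ p = 1)
    (hq : ∀ g : G, (ρ g).hom ≫ q = q) [IsIntegral X'] [IsLocallyNoetherian X'] [X'.IsSeparated] [IsAffine X'] [X₁.IsSeparated] [IsFinite q]
    (hreg : Scheme.IsRegular X') {k' : Type} [Field k'] (φ : X₁ ⟶ Spec (.of k')) [LocallyOfFiniteType φ]
    {k : Type} [Field k] (σ : MvPolynomial (Fin 4) k ≃+* MvPolynomial (Fin 4) k) (hC : ∀ a : k, σ (C a) = C a)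
    (h0 : σ (X 0) = X 0) (h1 : σ (X 1) = X 1 + X 0) (h2 : σ (X 2) = X 2 + X 1) (h3 : σ (X 3) = X 3)
    (e : Γ(X', ⊤) ≃+* MvPolynomial (Fin 4) k)
    (hστ : ∀ t : Γ(X', ⊤), e ((ρ g₀⁻¹).hom.appLE ⊤ ⊤ (by rw [Scheme.Hom.preimage_top]) t) = σ (e t))
    (h₀ : NodeAtlas p (⟨ρ, hq⟩ : ActionOver q G) g₀) :
    KillsIn 1 (GModel.initial (p := p) (g₀ := g₀) hq h₀) := by
  obtain ⟨𝒦, d, hprin, -, -, hchart⟩ := exists_isPrincipalCentre_initial_of_j3 (p := p) hp.pos hG hg₀ hq hreg σ hC h0 h1 h2 h3 e hστ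
  haveI : IsAffine (⊤ : X'.Opens) := isAffineOpen_top X'
  have hAff : IsAffineHom ((⊤ : X'.Opens).ι ≫ q) := inferInstance
  have hst : ∀ g : G, (ρ g).hom ⁻¹ᵁ (⊤ : X'.Opens) = ⊤ := fun g => Scheme.Hom.preimage_top _
  let O : (GModel.initial (p := p) (g₀ := g₀) hq h₀).act.StableAffineOpens := ⟨⊤, hst, hAff⟩
  exact killsIn_one_of_principalCentreChart_top hp hG (GModel.initial hq h₀) (hasNoetherianBase_of_datum φ _)
    ⟨NodeAtlasData.ofNodeAtlas (p := p) (ρ := (⟨ρ, hq⟩ : ActionOver q G)) (g₀ := g₀) h₀⟩ 𝒦 d hprin O rfl (hchart O rfl)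

/-- ★★★ **INSTANCE I-5c OF RECORD: the `J₃ ⊕ J₁` datum (j3) satisfies the conclusion of `ReachLowerInF(X)`** at its initial model with ANY root decoration
`𝔄₀` (`exists_reachLowerF_of_killsIn_datum` on `j3_killsIn_one`). [OURS · L1 W4.5c · R-F15g (2) I-5c; NOT a statement of the manuscript] -/
theorem exists_reachLowerF_initial_of_j3 [Finite G] (hp : p.Prime) (hG : ∀ g : G, g ∈ Subgroup.zpowers g₀) (hg₀ : g₀ ^ p = 1)
    (hq : ∀ g : G, (ρ g).hom ≫ q = q) [IsIntegral X'] [IsLocallyNoetherian X'] [X'.IsSeparated] [IsAffine X'] [X₁.IsSeparated] [IsFinite q]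
    (hreg : Scheme.IsRegular X') {k' : Type} [Field k'] (φ : X₁ ⟶ Spec (.of k')) [LocallyOfFiniteType φ]
    {k : Type} [Field k] (σ : MvPolynomial (Fin 4) k ≃+* MvPolynomial (Fin 4) k) (hC : ∀ a : k, σ (C a) = C a)
    (h0 : σ (X 0) = X 0) (h1 : σ (X 1) = X 1 + X 0) (h2 : σ (X 2) = X 2 + X 1) (h3 : σ (X 3) = X 3)
    (e : Γ(X', ⊤) ≃+* MvPolynomial (Fin 4) k)
    (hστ : ∀ t : Γ(X', ⊤), e ((ρ g₀⁻¹).hom.appLE ⊤ ⊤ (by rw [Scheme.Hom.preimage_top]) t) = σ (e t))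
    (h₀ : NodeAtlas p (⟨ρ, hq⟩ : ActionOver q G) g₀) (𝔄₀ : NodeAtlasData p (GModel.initial hq h₀).act g₀) :
    ∃ P : ∀ M : GModel p q G ρ g₀, NodeAtlasData p M.act g₀ → Prop,
      P (GModel.initial hq h₀) 𝔄₀ ∧ ∀ (M : GModel p q G ρ g₀) (𝔄 : NodeAtlasData p M.act g₀), P M 𝔄 → ¬ M.Terminal →
        ∃ n : ℕ, TreeF P (fun N 𝔅 => LexLTF N 𝔅 M 𝔄) n M 𝔄 :=
  exists_reachLowerF_of_killsIn_datum hp hG φ (GModel.initial hq h₀) 𝔄₀ (j3_killsIn_one hp hG hg₀ hq hreg φ σ hC h0 h1 h2 h3 e hστ h₀)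

/-- **INSTANCE I-5c, literal form**: the conclusion of `ReachLowerInF p` for the j3 datum with the stub's root decoration `NodeAtlasData.ofNodeAtlas h₀`.
[OURS · L1 W4.5c · R-F15g (2) I-5c] -/
theorem exists_reachLowerF_initial_ofNodeAtlas_of_j3 [Finite G] (hp : p.Prime) (hG : ∀ g : G, g ∈ Subgroup.zpowers g₀) (hg₀ : g₀ ^ p = 1)
    (hq : ∀ g : G, (ρ g).hom ≫ q = q) [IsIntegral X'] [IsLocallyNoetherian X'] [X'.IsSeparated] [IsAffine X'] [X₁.IsSeparated] [IsFinite q]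
    (hreg : Scheme.IsRegular X') {k' : Type} [Field k'] (φ : X₁ ⟶ Spec (.of k')) [LocallyOfFiniteType φ]
    {k : Type} [Field k] (σ : MvPolynomial (Fin 4) k ≃+* MvPolynomial (Fin 4) k) (hC : ∀ a : k, σ (C a) = C a)
    (h0 : σ (X 0) = X 0) (h1 : σ (X 1) = X 1 + X 0) (h2 : σ (X 2) = X 2 + X 1) (h3 : σ (X 3) = X 3)
    (e : Γ(X', ⊤) ≃+* MvPolynomial (Fin 4) k)
    (hστ : ∀ t : Γ(X', ⊤), e ((ρ g₀⁻¹).hom.appLE ⊤ ⊤ (by rw [Scheme.Hom.preimage_top]) t) = σ (e t))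
    (h₀ : NodeAtlas p (⟨ρ, hq⟩ : ActionOver q G) g₀) :
    ∃ P : ∀ M : GModel p q G ρ g₀, NodeAtlasData p M.act g₀ → Prop,
      P (GModel.initial hq h₀) (NodeAtlasData.ofNodeAtlas (p := p) (ρ := (⟨ρ, hq⟩ : ActionOver q G)) (g₀ := g₀) h₀) ∧
      ∀ (M : GModel p q G ρ g₀) (𝔄 : NodeAtlasData p M.act g₀), P M 𝔄 → ¬ M.Terminal →
        ∃ n : ℕ, TreeF P (fun N 𝔅 => LexLTF N 𝔅 M 𝔄) n M 𝔄 :=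
  exists_reachLowerF_initial_of_j3 hp hG hg₀ hq hreg φ σ hC h0 h1 h2 h3 e hστ h₀ _

end Summit.ResolutionOfSingularities.ResolutionOfSingularities.Theorems.WildQuotientResolution.S1.GameFrame.GModel

end
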